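import Summits.QuantumFields.BalabanUV.T4Continuum.Support.NE9B11ChartAnalytic
import Literature.MathematicalPhysics.QuantumFieldTheory.Balaban1983to89.B9Eq315QTorusOnto
import Literature.MathematicalPhysics.QuantumFieldTheory.Balaban1983to89.B11Eq118RegimeRadii
import Literature.MathematicalPhysics.QuantumFieldTheory.Balaban1983to89.B11Eq44COperatorTorus
import Literature.MathematicalPhysics.QuantumFieldTheory.Balaban1983to89.B9Ineq369CurvatureSmall
import Literature.MathematicalPhysics.QuantumFieldTheory.Balaban1983to89.B5Eq172FlatCoercivity
import Literature.MathematicalPhysics.QuantumFieldTheory.Balaban1983to89.B9Thm311SmallFieldClosed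

/-!
# NE9CurChartOfBackground — THE CHART OF THE CURVE SPECIES `cur U` EXISTS AS AN ANALYTIC OBJECT AT THE CONSTRUCTED LETTERS OF THE
# BACKGROUND `U`, modulo the (L3) letter `W` and the displayed positivity: route R2′ of `t4/ROUTES-NE9.md` («`cur` by B11's displayed
# contractions») ASSEMBLED at 𝔊(U), H₁(U) (pub-balaban NE9 owner files `B11Eq103H1Complex`, with «Q onto» DISCHARGED by
# `B9Eq315QTorusOnto.QtorusW_surjective`), H(U) (`B11Eq45HOperator.HopAd`, NE9 leaf-03), C(U) (`B11Eq44COperatorTorus.Cc` WITH its proved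
# `quadAnalytic_Cc` / `analyticOnNhd_Cc`, NE9 leaf-03 p299516) and ALL scalar letters CHOSEN (`B11Eq118RegimeRadii.exists_twoRegimes_radii`);
# cell `pub-balaban`, T4-DAG §2 node U3 / §6 NE9, WALL-NE9-P1 §3 (ii); BINDER row NE9 OWNER lineage `b2b-balaban-t4-ne9-p1`, generation 78;
# Summits-side NEW work under the owner's INTERFACE REQUEST NE9 of this generation (ruling e34b3e0c (0): «no new leaves unless a CRUX prover
# requests a specific NAMED interface»), nothing printed asserted

HONEST FRAMING (T4-DAG PAGE 1).  Rung (B)+1 of the FINITE-VOLUME T⁴ programme — NOT infinite volume, NOT a mass gap, NOT the Clay problem.  NE9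
(`T4OutputRate.NE9` ∧ `FadingMemory`) is a cell NEW ESTIMATE, NOT PRINTED in [I] = [Balaban1987RG1] (CMP **109**), [II] = [Balaban1988RG2Cluster]
(CMP **116**), and NOT PROVED here («NE9 ⇐ the named binders»; spine PROVED 0∕9).  HONEST DEPENDENCY (cell line, verbatim): continuum YM on T⁴ ⇐
BetaPertH ∧ nine spine estimates (0/9 proved); BetaPertH ⇐ (D1) ∧ (D4) ∧ CAP+tail; G-an2-4 gates asym, D1 and NE2/3/4.  The `cur U` OBJECT is ONE
item of the MODEL O-NE9-1 (species (a) data); the END's `act` / `ker` halves, NEEDS-COORDINATOR #5 and the positivity [Balaban1985BackgroundPropagators]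
Thm 3.11 (`hpos`, DISPLAYED by the ABSOLUTE RULE) are untouched.

WHAT THIS FILE PROVES (TWO theorems; 0 def, 0 sorry, axioms standard).  **`cur_chart_exists_of_W`**: for a background `U` on the torus `T_{L·m}`
with E162's displayed data (unit-bounded extension, α-regular block loops with `α ≤ 1/128` and the small-field regime `50(d+1)·α·L^d ≤ 1/2`),
the fibre/trace readings `φ`/`τ`, weights `c₀, c₁ > 0`, the number `a`, the DISPLAYED positivity `hpos` of the assembled `Δ_a(U)`
(`B9Eq315QTorus.laplaceAofBackground`), ANY (L3) slot `W` with `QuadAnalytic W C₄ a₃` analytic on its ball, H's kernel datum `kH`, and level maps with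
`1 ≤ lev₀`: THERE ARE radii `ε₄ ε_C R_b R′ > 0` such that lit-balaban's chart (174)∘(47)
`chartHB 𝔊(U) 0 W 0 (A′ ↦ A′ + solA H(U) 0 C(U) 0 ε_C A′) ε₄ H₁(U)` is Fréchet-differentiable on `ball 0 R_b`, maps it into `ball 0 R′`, and
fixes `0` — the binders (Ψ1)–(Ψ3) of the `cur` species' background map (`NE9CurveFromBackgroundMap`, `NE9CurOfB11Chart`), with EVERY operator
letter an object of `U` and EVERY scalar letter chosen.  MECHANISM: `NE9B11ChartAnalytic.chartHB_triple_of_twoRegimes` (E116) at the Regimes of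
`exists_twoRegimes_radii` (B₀ := ‖𝔊(U)‖, b := ‖H(U)‖, θ = 0).  **`cur_chart_exists_of_W_H126`**: the same with `H` read by [B9] (3.126)
«HB = GQ*(QGQ*)⁻¹B» at the background `U` — `H := H1LatticeCLM …` (the construction of `H₁`), so that NO kernel datum remains: the chart of `cur U`
exists given ONLY `hpos`, the (L3) slot `W`, `1 ≤ lev₀` and the background data.
DISGUISE TEST: composition of landed theorems; no inequality of the series proved (the operator norms are finite-lattice constants — uniformity =
[B9] Thms 3.12/3.13, displayed elsewhere); not NE9.
References (TYPES ∕ loci only): [Balaban1985Variational] (45)–(47) p. 285, Prop. 6 p. 295, (172)–(175) p. 305; [Balaban1985BackgroundPropagators]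
(3.15) p. 393, (3.21)–(3.26) pp. 394–395, Thm 3.11 p. 416, (3.126) p. 420; [Balaban1987RG1] Lemma 4 (3.53) p. 280 (the range class only).
Imports `NE9B11ChartAnalytic`, `B9Eq315QTorusOnto`, `B11Eq118RegimeRadii`, `B11Eq44COperatorTorus`; modifies nothing; no END re-wired.
Value = WALL-NE9-P1 §3 (ii) «the chart of `cur U` at the constructed letters» as a NAMED theorem modulo (L3) W; NOT summit progress.
v1.1 (gen 78, APPEND-ONLY; the two v1 theorems byte-identical): + `cur_chart_exists_of_principal_coercive` — `hpos` DISCHARGED down to the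
coercivity of the principal gauge-fixed operator `D*D + DR(U)D* + aQ(U)*Q(U)` (displayed) + the PROVED smallness of the curvature part
(`B9Ineq369CurvatureSmall`, [Balaban1985BackgroundPropagators] p. 392 / (3.69) p. 404); new import `B9Ineq369CurvatureSmall`.
v1.2 (gen 79, APPEND-ONLY; v1/v1.1 byte-identical): + `cur_chart_exists_flat` — AT THE FLAT BACKGROUND `U = 1` the positivity `hpos` is a THEOREM
(`B5Eq172FlatCoercivity.laplaceAofBackground_one_pos`: [Balaban1984PropagatorsI] p. 30 (1.72), the one-step prototype of [Balaban1985BackgroundPropagators]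
p. 416 «G_□(1) is positive» (ref. [4] there = [Balaban1984PropagatorsII]),
proved from the Hodge decomposition of the torus + (1.55) + the flat averaging identities), so the chart of `cur 1` exists given ONLY the (L3) letter
`W`; new import `B5Eq172FlatCoercivity`.
v1.3 (gen 80, APPEND-ONLY; v1/v1.1/v1.2 byte-identical): + `cur_chart_exists_of_small_field` — AT EVERY SMALL FIELD `U` OF A FIXED LATTICE the
positivity `hpos` is a THEOREM (`B9Thm311SmallFieldClosed.laplaceAofBackground_pos_of_small_field`: [Balaban1985BackgroundPropagators] Thm 3.11 for
the chain's assembled `Δ_a(U)` — the flat coercivity of [Balaban1984PropagatorsI] (1.72) perturbed by the PROVED remainders of `D`, `D*`, `D*D`,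
`Δ^η_U`, `R(U)` (owner gen 80), `Q′(U)` (NE9 leaf-03), `Q(U)` (NE9 leaf-04) and the curvature part (owner gen 78), p. 416 / (3.82)–(3.86)), so the
chart of `cur U` exists given ONLY the (L3) letter `W`, the mutual adjointness `hRS` of the transporters and the trace/fibre letters `C_τ`, `M_φ`,
`M_φ′`; new import `B9Thm311SmallFieldClosed`.
-/

noncomputable section

open Metric Set

namespace Summit.QuantumFields.BalabanUV.T4Continuum.NE9CurChartOfBackground

open Literature.MathematicalPhysics.QuantumFieldTheory.Balaban1983to89
open B11Eq103H1Complex B11Eq115Space B11Eq174Chart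
open B11Eq111FrakG (nabla115)
open B13Contraction113 (QuadAnalytic)
open B9Eq319QprimeTorus (fineP)
open B9SectCLatticeCarrier (Bond)
open B4Sect5Torus (TSite)
open B7Prop1Explicit (U1 Wcx boxVec)
open B9Eq315QTorus (perCfg cornerSite QtorusW laplaceAofBackground)
open B9Eq315QTorusOnto (QtorusW_surjective)
open B11Eq118RegimeRadii (exists_twoRegimes_radii)
open B11Eq45HOperator (HopAd)
open B11Eq44COperatorTorus (Cc quadAnalytic_Cc analyticOnNhd_Cc)
open Summit.QuantumFields.BalabanUV.T4Continuum.NE9B11ChartAnalytic (chartHB_triple_of_twoRegimes)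

/-- **THE CHART OF `cur U` EXISTS AS AN ANALYTIC OBJECT ON A BALL, AT THE CONSTRUCTED LETTERS, MODULO THE (L3) LETTER `W` AND THE DISPLAYED
POSITIVITY**: with `𝔊(U) := frakGLatticeCLM …`, `H₁(U) := H1LatticeCLM …` (both with «Q onto» := `QtorusW_surjective`), `H(U) := HopAd …`,
`C(U) := Cc …` (its `QuadAnalytic`/analyticity PROVED by leaf-03) and the radii of `exists_twoRegimes_radii`, lit-balaban's chart (174)∘(47)
satisfies (Ψ1)–(Ψ3) on some ball. [folklore] -/
theorem cur_chart_exists_of_W {d : ℕ} (L : ℕ) [NeZero L] (m : Fin d → ℕ) [∀ i, NeZero (fineP L m i)] (hL : 1 ≤ L)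
    {𝔸 : Type*} [NormedRing 𝔸] [NormedAlgebra ℂ 𝔸] [CompleteSpace 𝔸] [NormOneClass 𝔸] [StarRing 𝔸] [StarModule ℂ 𝔸] [FiniteDimensional ℂ 𝔸]
    {W : Type*} [NormedAddCommGroup W] [InnerProductSpace ℂ W] [FiniteDimensional ℂ W] (φ : W ≃ₗ[ℂ] 𝔸) (τ : 𝔸 →ₗ[ℂ] ℂ)
    {η : ℝ} [Fact (0 < (L : ℝ))] [Fact (0 < η)] {lev₀ : Bond d (fineP L m) → ℕ} {levB : Bond d m → ℕ} (lev₁ : Bond d (fineP L m) × Fin d → ℕ)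
    (hlev : ∀ b, 1 ≤ lev₀ b)
    (U : Bond d (fineP L m) → 𝔸ˣ) {α : ℝ} (hα : α ≤ 1 / 128) (hα1 : α ≤ 1 / 64)
    (hU1 : ∀ (x : B7Prop1Explicit.Site d) (κ : Fin d), perCfg (fineP L m) U x κ ∈ U1 𝔸)
    (hreg : ∀ (y : TSite d m) (κ : Fin d) (r : Fin d → Fin L),
      ‖((Wcx L (perCfg (fineP L m) U) (cornerSite L y) κ (boxVec L r) : 𝔸ˣ) : 𝔸) - 1‖ ≤ α)
    (hαL : 50 * (d + 1) * α * (L : ℝ) ^ d ≤ 1 / 2)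
    {c₀ c₁ : ℝ} [Fact (0 < c₀)] [Fact (0 < c₁)] (a : ℝ)
    (hpos : ∀ x : BondL2K ℂ d (fineP L m) c₀ W, x ≠ 0 →
      0 < RCLike.re (inner ℂ x (laplaceAofBackground L m hL φ U hα1 hU1 hreg τ η (c₀ := c₀) (c₁ := c₁) a x)))
    {Wq : Space115 (L : ℝ) η lev₀ lev₁ (nabla115 η U) → NegSize (L : ℝ) η lev₀ 3 𝔸} {C₄ a₃ : ℝ} (hW : QuadAnalytic Wq C₄ a₃) (hC₄ : 0 ≤ C₄)
    (ha₃ : 0 < a₃) (hWa : AnalyticOnNhd ℂ Wq {Y | ‖Y‖ < a₃})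
    (kH : Bond d (fineP L m) → Bond d m → (𝔸 →L[ℂ] 𝔸)) :
    ∃ ε₄ εC Rb R' : ℝ, 0 < Rb ∧ 0 < R' ∧
      DifferentiableOn ℂ (chartHB (frakGLatticeCLM (lev₀ := lev₀) φ hpos (QtorusW_surjective L m hL U hα1 hU1 hreg hαL φ) lev₁ (nabla115 η U))
          0 Wq 0 (fun A' => A' + solA (HopAd (L : ℝ) η levB lev₀ lev₁ U kH) 0 (Cc L m η U lev₀ lev₁ (nabla115 η U) levB) 0 εC A') ε₄
          (H1LatticeCLM (lev₀ := lev₀) (levB := levB) φ hpos (QtorusW_surjective L m hL U hα1 hU1 hreg hαL φ) lev₁ (nabla115 η U)))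
        (ball (0 : NegSize (L : ℝ) η levB 0 𝔸) Rb) ∧
      MapsTo (chartHB (frakGLatticeCLM (lev₀ := lev₀) φ hpos (QtorusW_surjective L m hL U hα1 hU1 hreg hαL φ) lev₁ (nabla115 η U))
          0 Wq 0 (fun A' => A' + solA (HopAd (L : ℝ) η levB lev₀ lev₁ U kH) 0 (Cc L m η U lev₀ lev₁ (nabla115 η U) levB) 0 εC A') ε₄
          (H1LatticeCLM (lev₀ := lev₀) (levB := levB) φ hpos (QtorusW_surjective L m hL U hα1 hU1 hreg hαL φ) lev₁ (nabla115 η U)))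
        (ball (0 : NegSize (L : ℝ) η levB 0 𝔸) Rb) (ball (0 : Space115 (L : ℝ) η lev₀ lev₁ (nabla115 η U)) R') ∧
      chartHB (frakGLatticeCLM (lev₀ := lev₀) φ hpos (QtorusW_surjective L m hL U hα1 hU1 hreg hαL φ) lev₁ (nabla115 η U))
          0 Wq 0 (fun A' => A' + solA (HopAd (L : ℝ) η levB lev₀ lev₁ U kH) 0 (Cc L m η U lev₀ lev₁ (nabla115 η U) levB) 0 εC A') ε₄
          (H1LatticeCLM (lev₀ := lev₀) (levB := levB) φ hpos (QtorusW_surjective L m hL U hα1 hU1 hreg hαL φ) lev₁ (nabla115 η U)) 0 = 0 := by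
  have hC := quadAnalytic_Cc L m η U lev₀ lev₁ (nabla115 η U) levB hL hα hU1 hreg hlev
  have hCa := analyticOnNhd_Cc L m η U lev₀ lev₁ (nabla115 η U) levB hL hα hU1 hreg hlev
  obtain ⟨j, a', ε₄, aC, εC, R', Rb, hj, ha', -, -, -, hR'0, hRb0, R, RC, hcap, hRb, hR'⟩ :=
    exists_twoRegimes_radii (frakGLatticeCLM (lev₀ := lev₀) φ hpos (QtorusW_surjective L m hL U hα1 hU1 hreg hαL φ) lev₁ (nabla115 η U))
      hW hC₄ ha₃ (HopAd (L : ℝ) η levB lev₀ lev₁ U kH) hC (by positivity) (by positivity)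
      (H1LatticeCLM (lev₀ := lev₀) (levB := levB) φ hpos (QtorusW_surjective L m hL U hα1 hU1 hreg hαL φ) lev₁ (nabla115 η U))
  exact ⟨ε₄, εC, Rb, R', hRb0, hR'0, chartHB_triple_of_twoRegimes R hWa hj.le ha' RC hCa hcap _ hRb hR'0 hR'⟩

/-- **THE SAME WITH `H` OF [B11] (45) READ BY [B9] (3.126) «HB = GQ*(QGQ*)⁻¹B» AT THE BACKGROUND `U`** — i.e. `H := H1LatticeCLM …` (the SAME
construction as `H₁`, E154's `G₁Q†(QG₁Q†)⁻¹` at the assembled `Δ_a(U)`): then NO kernel datum is left and the chart of `cur U` exists given ONLY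
the displayed positivity `hpos`, the (L3) slot `W` (quadratic-analytic), `1 ≤ lev₀` and E162's background data.  (leaf-03's kernel road `HopAd U kH`
with its displayed row sums — print's uniformity route via [B9] Thm 3.12 — is the alternative reading, `cur_chart_exists_of_W`.) [folklore] -/
theorem cur_chart_exists_of_W_H126 {d : ℕ} (L : ℕ) [NeZero L] (m : Fin d → ℕ) [∀ i, NeZero (fineP L m i)] (hL : 1 ≤ L)
    {𝔸 : Type*} [NormedRing 𝔸] [NormedAlgebra ℂ 𝔸] [CompleteSpace 𝔸] [NormOneClass 𝔸] [StarRing 𝔸] [StarModule ℂ 𝔸] [FiniteDimensional ℂ 𝔸]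
    {W : Type*} [NormedAddCommGroup W] [InnerProductSpace ℂ W] [FiniteDimensional ℂ W] (φ : W ≃ₗ[ℂ] 𝔸) (τ : 𝔸 →ₗ[ℂ] ℂ)
    {η : ℝ} [Fact (0 < (L : ℝ))] [Fact (0 < η)] {lev₀ : Bond d (fineP L m) → ℕ} {levB : Bond d m → ℕ} (lev₁ : Bond d (fineP L m) × Fin d → ℕ)
    (hlev : ∀ b, 1 ≤ lev₀ b)
    (U : Bond d (fineP L m) → 𝔸ˣ) {α : ℝ} (hα : α ≤ 1 / 128) (hα1 : α ≤ 1 / 64)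
    (hU1 : ∀ (x : B7Prop1Explicit.Site d) (κ : Fin d), perCfg (fineP L m) U x κ ∈ U1 𝔸)
    (hreg : ∀ (y : TSite d m) (κ : Fin d) (r : Fin d → Fin L),
      ‖((Wcx L (perCfg (fineP L m) U) (cornerSite L y) κ (boxVec L r) : 𝔸ˣ) : 𝔸) - 1‖ ≤ α)
    (hαL : 50 * (d + 1) * α * (L : ℝ) ^ d ≤ 1 / 2)
    {c₀ c₁ : ℝ} [Fact (0 < c₀)] [Fact (0 < c₁)] (a : ℝ)
    (hpos : ∀ x : BondL2K ℂ d (fineP L m) c₀ W, x ≠ 0 →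
      0 < RCLike.re (inner ℂ x (laplaceAofBackground L m hL φ U hα1 hU1 hreg τ η (c₀ := c₀) (c₁ := c₁) a x)))
    {Wq : Space115 (L : ℝ) η lev₀ lev₁ (nabla115 η U) → NegSize (L : ℝ) η lev₀ 3 𝔸} {C₄ a₃ : ℝ} (hW : QuadAnalytic Wq C₄ a₃) (hC₄ : 0 ≤ C₄)
    (ha₃ : 0 < a₃) (hWa : AnalyticOnNhd ℂ Wq {Y | ‖Y‖ < a₃}) :
    ∃ ε₄ εC Rb R' : ℝ, 0 < Rb ∧ 0 < R' ∧
      DifferentiableOn ℂ (chartHB (frakGLatticeCLM (lev₀ := lev₀) φ hpos (QtorusW_surjective L m hL U hα1 hU1 hreg hαL φ) lev₁ (nabla115 η U))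
          0 Wq 0 (fun A' => A' + solA (H1LatticeCLM (lev₀ := lev₀) (levB := levB) φ hpos (QtorusW_surjective L m hL U hα1 hU1 hreg hαL φ) lev₁ (nabla115 η U))
            0 (Cc L m η U lev₀ lev₁ (nabla115 η U) levB) 0 εC A') ε₄
          (H1LatticeCLM (lev₀ := lev₀) (levB := levB) φ hpos (QtorusW_surjective L m hL U hα1 hU1 hreg hαL φ) lev₁ (nabla115 η U)))
        (ball (0 : NegSize (L : ℝ) η levB 0 𝔸) Rb) ∧
      MapsTo (chartHB (frakGLatticeCLM (lev₀ := lev₀) φ hpos (QtorusW_surjective L m hL U hα1 hU1 hreg hαL φ) lev₁ (nabla115 η U))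
          0 Wq 0 (fun A' => A' + solA (H1LatticeCLM (lev₀ := lev₀) (levB := levB) φ hpos (QtorusW_surjective L m hL U hα1 hU1 hreg hαL φ) lev₁ (nabla115 η U))
            0 (Cc L m η U lev₀ lev₁ (nabla115 η U) levB) 0 εC A') ε₄
          (H1LatticeCLM (lev₀ := lev₀) (levB := levB) φ hpos (QtorusW_surjective L m hL U hα1 hU1 hreg hαL φ) lev₁ (nabla115 η U)))
        (ball (0 : NegSize (L : ℝ) η levB 0 𝔸) Rb) (ball (0 : Space115 (L : ℝ) η lev₀ lev₁ (nabla115 η U)) R') ∧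
      chartHB (frakGLatticeCLM (lev₀ := lev₀) φ hpos (QtorusW_surjective L m hL U hα1 hU1 hreg hαL φ) lev₁ (nabla115 η U))
          0 Wq 0 (fun A' => A' + solA (H1LatticeCLM (lev₀ := lev₀) (levB := levB) φ hpos (QtorusW_surjective L m hL U hα1 hU1 hreg hαL φ) lev₁ (nabla115 η U))
            0 (Cc L m η U lev₀ lev₁ (nabla115 η U) levB) 0 εC A') ε₄
          (H1LatticeCLM (lev₀ := lev₀) (levB := levB) φ hpos (QtorusW_surjective L m hL U hα1 hU1 hreg hαL φ) lev₁ (nabla115 η U)) 0 = 0 := by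
  have hC := quadAnalytic_Cc L m η U lev₀ lev₁ (nabla115 η U) levB hL hα hU1 hreg hlev
  have hCa := analyticOnNhd_Cc L m η U lev₀ lev₁ (nabla115 η U) levB hL hα hU1 hreg hlev
  obtain ⟨j, a', ε₄, aC, εC, R', Rb, hj, ha', -, -, -, hR'0, hRb0, R, RC, hcap, hRb, hR'⟩ :=
    exists_twoRegimes_radii (frakGLatticeCLM (lev₀ := lev₀) φ hpos (QtorusW_surjective L m hL U hα1 hU1 hreg hαL φ) lev₁ (nabla115 η U))
      hW hC₄ ha₃ (H1LatticeCLM (lev₀ := lev₀) (levB := levB) φ hpos (QtorusW_surjective L m hL U hα1 hU1 hreg hαL φ) lev₁ (nabla115 η U))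
      hC (by positivity) (by positivity)
      (H1LatticeCLM (lev₀ := lev₀) (levB := levB) φ hpos (QtorusW_surjective L m hL U hα1 hU1 hreg hαL φ) lev₁ (nabla115 η U))
  exact ⟨ε₄, εC, Rb, R', hRb0, hR'0, chartHB_triple_of_twoRegimes R hWa hj.le ha' RC hCa hcap _ hRb hR'0 hR'⟩

/-! ## v1.1 (gen 78, APPEND-ONLY): `hpos` REPLACED by the principal coercivity + the smallness letters of `B9Ineq369CurvatureSmall` -/

section SmallCurvature

open B9Ineq369CurvatureSmall (hpos_of_smallCurvature)
open B9Eq310HessianOperator (adTransportW principalOpK)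
open B9Eq326OperatorAssembly (RofU)
open B9Eq310DeltaPrime (plaqHolU)
open B9Eq315QTorusOnto (liftSite perSite_liftSite)

/-- **THE CHART OF `cur U` FROM THE PRINCIPAL COERCIVITY** — `cur_chart_exists_of_W_H126` with its displayed positivity `hpos` ([B9] Thm 3.11 for the
assembled `Δ_a(U)`) DISCHARGED down to (i) the coercivity `γ‖x‖² ≤ re⟪x, (D*D + DR(U)D* + aQ(U)*Q(U))x⟫` of the PRINCIPAL gauge-fixed operator
(the substance of Thm 3.11 / of [4]; DISPLAYED) and (ii) PROVED smallness of the curvature part: `‖U(∂p) − 1‖ ≤ ε` on every plaquette with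
`32d·C_τ·M_φ²·(|η|^d/c₀)·η⁻²ε < γ` (`B9Ineq369CurvatureSmall.hpos_of_smallCurvature`; `C_τ`, `M_φ` bounds of the trace datum and the fibre
identification, isometric star).  The unit-boundedness of the bond variables is READ OFF E162's `hU1`. [folklore] -/
theorem cur_chart_exists_of_principal_coercive {d : ℕ} (L : ℕ) [NeZero L] (m : Fin d → ℕ) [∀ i, NeZero (fineP L m i)] (hL : 1 ≤ L)
    {𝔸 : Type*} [NormedRing 𝔸] [NormedAlgebra ℂ 𝔸] [CompleteSpace 𝔸] [NormOneClass 𝔸] [StarRing 𝔸] [NormedStarGroup 𝔸] [StarModule ℂ 𝔸]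
    [FiniteDimensional ℂ 𝔸]
    {W : Type*} [NormedAddCommGroup W] [InnerProductSpace ℂ W] [FiniteDimensional ℂ W] (φ : W ≃ₗ[ℂ] 𝔸) {Mφ : ℝ} (hφ : ∀ w, ‖φ w‖ ≤ Mφ * ‖w‖)
    (τ : 𝔸 →ₗ[ℂ] ℂ) {Cτ : ℝ} (hτ : ∀ X, ‖τ X‖ ≤ Cτ * ‖X‖) (hCτ : 0 ≤ Cτ)
    {η : ℝ} [Fact (0 < (L : ℝ))] [Fact (0 < η)] {lev₀ : Bond d (fineP L m) → ℕ} {levB : Bond d m → ℕ} (lev₁ : Bond d (fineP L m) × Fin d → ℕ)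
    (hlev : ∀ b, 1 ≤ lev₀ b)
    (U : Bond d (fineP L m) → 𝔸ˣ) {α : ℝ} (hα : α ≤ 1 / 128) (hα1 : α ≤ 1 / 64)
    (hU1 : ∀ (x : B7Prop1Explicit.Site d) (κ : Fin d), perCfg (fineP L m) U x κ ∈ U1 𝔸)
    (hreg : ∀ (y : TSite d m) (κ : Fin d) (r : Fin d → Fin L),
      ‖((Wcx L (perCfg (fineP L m) U) (cornerSite L y) κ (boxVec L r) : 𝔸ˣ) : 𝔸) - 1‖ ≤ α)
    (hαL : 50 * (d + 1) * α * (L : ℝ) ^ d ≤ 1 / 2)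
    {ε : ℝ} (hpl : ∀ p : B9SectCLatticeCarrier.Plaq d (fineP L m), ‖(plaqHolU U p : 𝔸) - 1‖ ≤ ε) (hε : 0 ≤ ε)
    {c₀ c₁ : ℝ} [Fact (0 < c₀)] [Fact (0 < c₁)] (a : ℝ) {γ : ℝ}
    -- the ONE displayed inequality: coercivity of the PRINCIPAL gauge-fixed operator `D*D + D R(U) D* + a Q(U)*Q(U)`
    (hγ : ∀ x : BondL2K ℂ d (fineP L m) c₀ W, γ * ‖x‖ ^ 2 ≤
      RCLike.re (inner ℂ x (laplaceALatticeK ((η : ℂ))⁻¹ (adTransportW φ U) (adTransportW φ fun b => (U b)⁻¹) (principalOpK φ η U)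
        (RofU L m φ η U) (QtorusW L m hL φ U hα1 hU1 hreg (c₁ := c₁)) a x)))
    (hsmall : 32 * d * Cτ * Mφ ^ 2 * (|η| ^ d / c₀) * (‖((η : ℂ))⁻¹‖ ^ 2 * ε) < γ)
    {Wq : Space115 (L : ℝ) η lev₀ lev₁ (nabla115 η U) → NegSize (L : ℝ) η lev₀ 3 𝔸} {C₄ a₃ : ℝ} (hW : QuadAnalytic Wq C₄ a₃) (hC₄ : 0 ≤ C₄)
    (ha₃ : 0 < a₃) (hWa : AnalyticOnNhd ℂ Wq {Y | ‖Y‖ < a₃}) :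
    let hUb : ∀ b : Bond d (fineP L m), ‖(U b : 𝔸)‖ ≤ 1 ∧ ‖(((U b)⁻¹ : 𝔸ˣ) : 𝔸)‖ ≤ 1 := fun b => by
      obtain ⟨y, κ⟩ := b
      have h := hU1 (liftSite y) κ
      rw [B9Eq315QTorus.perCfg_apply, perSite_liftSite] at h
      exact B7Prop1Explicit.mem_U1.1 h
    let hpos : ∀ x : BondL2K ℂ d (fineP L m) c₀ W, x ≠ 0 →
        0 < RCLike.re (inner ℂ x (laplaceAofBackground L m hL φ U hα1 hU1 hreg τ η (c₀ := c₀) (c₁ := c₁) a x)) :=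
      fun x hx => hpos_of_smallCurvature φ hτ hCτ hφ η hUb hpl hε _ _ _ _ _ a hγ hsmall x hx
    ∃ ε₄ εC Rb R' : ℝ, 0 < Rb ∧ 0 < R' ∧
      DifferentiableOn ℂ (chartHB (frakGLatticeCLM (lev₀ := lev₀) φ hpos (QtorusW_surjective L m hL U hα1 hU1 hreg hαL φ) lev₁ (nabla115 η U))
          0 Wq 0 (fun A' => A' + solA (H1LatticeCLM (lev₀ := lev₀) (levB := levB) φ hpos (QtorusW_surjective L m hL U hα1 hU1 hreg hαL φ) lev₁ (nabla115 η U))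
            0 (Cc L m η U lev₀ lev₁ (nabla115 η U) levB) 0 εC A') ε₄
          (H1LatticeCLM (lev₀ := lev₀) (levB := levB) φ hpos (QtorusW_surjective L m hL U hα1 hU1 hreg hαL φ) lev₁ (nabla115 η U)))
        (ball (0 : NegSize (L : ℝ) η levB 0 𝔸) Rb) ∧
      MapsTo (chartHB (frakGLatticeCLM (lev₀ := lev₀) φ hpos (QtorusW_surjective L m hL U hα1 hU1 hreg hαL φ) lev₁ (nabla115 η U))
          0 Wq 0 (fun A' => A' + solA (H1LatticeCLM (lev₀ := lev₀) (levB := levB) φ hpos (QtorusW_surjective L m hL U hα1 hU1 hreg hαL φ) lev₁ (nabla115 η U))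
            0 (Cc L m η U lev₀ lev₁ (nabla115 η U) levB) 0 εC A') ε₄
          (H1LatticeCLM (lev₀ := lev₀) (levB := levB) φ hpos (QtorusW_surjective L m hL U hα1 hU1 hreg hαL φ) lev₁ (nabla115 η U)))
        (ball (0 : NegSize (L : ℝ) η levB 0 𝔸) Rb) (ball (0 : Space115 (L : ℝ) η lev₀ lev₁ (nabla115 η U)) R') ∧
      chartHB (frakGLatticeCLM (lev₀ := lev₀) φ hpos (QtorusW_surjective L m hL U hα1 hU1 hreg hαL φ) lev₁ (nabla115 η U))
          0 Wq 0 (fun A' => A' + solA (H1LatticeCLM (lev₀ := lev₀) (levB := levB) φ hpos (QtorusW_surjective L m hL U hα1 hU1 hreg hαL φ) lev₁ (nabla115 η U))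
            0 (Cc L m η U lev₀ lev₁ (nabla115 η U) levB) 0 εC A') ε₄
          (H1LatticeCLM (lev₀ := lev₀) (levB := levB) φ hpos (QtorusW_surjective L m hL U hα1 hU1 hreg hαL φ) lev₁ (nabla115 η U)) 0 = 0 :=
  cur_chart_exists_of_W_H126 L m hL φ τ lev₁ hlev U hα hα1 hU1 hreg hαL a _ hW hC₄ ha₃ hWa

end SmallCurvature


/-! ## v1.2 (gen 79, APPEND-ONLY): AT THE FLAT BACKGROUND `hpos` IS A THEOREM — the chart of `cur 1` exists given ONLY the (L3) letter `W` -/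

section Flat

open B5Eq172FlatCoercivity (laplaceAofBackground_one_pos laplaceAofBackground_one_pos₀ hU1_one hreg_one)

set_option maxRecDepth 8192 in
/-- **THE CHART OF THE CURVE SPECIES AT THE FLAT BACKGROUND `U = 1` EXISTS GIVEN ONLY THE (L3) LETTER `W`** — `cur_chart_exists_of_W_H126` at
`U := 1` with its displayed positivity `hpos` ([Balaban1985BackgroundPropagators] Thm 3.11 for the assembled `Δ_a(1)`) DISCHARGED by
`B5Eq172FlatCoercivity.laplaceAofBackground_one_pos` — [Balaban1984PropagatorsI] p. 30 (1.72), the one-step torus prototype of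
[Balaban1985BackgroundPropagators] p. 416 «In [4] we have proved that the operator G_□(1) is positive» (ref. [4] there = [Balaban1984PropagatorsII]),
PROVED for the chain's letters from the Hodge decomposition of the torus (`B5Eq172PoincareTorus`), print's (1.55) for the chain's averaging pair
(`B5Eq155FlatAveragingCommute`, NE9 leaf-01) and the flat averaging identities (`B5Eq172FlatCoercivity`), via the abstract
positivity theorem `B5Eq172HodgePositivity`: for `0 < a` there are radii `ε₄ εC Rb R′ > 0` with (Ψ1)–(Ψ3) for lit-balaban's chart (174)∘(47) at the
flat letters `𝔊(1)`, `H₁(1)`, `C(1)`, ANY quadratic-analytic `W`.  What stays displayed at `U = 1`: the (L3) slot `W`, `1 ≤ lev₀`, the flat background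
data letters `hU1`/`hreg`/`hα`/`hαL` (inputs of `QtorusW`), `0 < a`.  NOT the general background (Thm 3.11's perturbation (3.86)); NOT uniformity.
[folklore] -/
theorem cur_chart_exists_flat {d : ℕ} (L : ℕ) [NeZero L] (m : Fin d → ℕ) [∀ i, NeZero (fineP L m i)] (hL : 1 ≤ L)
    {𝔸 : Type*} [NormedRing 𝔸] [NormedAlgebra ℂ 𝔸] [CompleteSpace 𝔸] [NormOneClass 𝔸] [StarRing 𝔸] [StarModule ℂ 𝔸] [FiniteDimensional ℂ 𝔸]
    {W : Type*} [NormedAddCommGroup W] [InnerProductSpace ℂ W] [FiniteDimensional ℂ W] (φ : W ≃ₗ[ℂ] 𝔸) (τ : 𝔸 →ₗ[ℂ] ℂ)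
    {η : ℝ} [Fact (0 < (L : ℝ))] [Fact (0 < η)] {lev₀ : Bond d (fineP L m) → ℕ} {levB : Bond d m → ℕ} (lev₁ : Bond d (fineP L m) × Fin d → ℕ)
    (hlev : ∀ b, 1 ≤ lev₀ b) {α : ℝ} (hα : α ≤ 1 / 128) (hα1 : α ≤ 1 / 64)
    (hU1 : ∀ (x : B7Prop1Explicit.Site d) (κ : Fin d), perCfg (fineP L m) (fun _ : Bond d (fineP L m) => (1 : 𝔸ˣ)) x κ ∈ U1 𝔸)
    (hreg : ∀ (y : TSite d m) (κ : Fin d) (r : Fin d → Fin L),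
      ‖((Wcx L (perCfg (fineP L m) (fun _ : Bond d (fineP L m) => (1 : 𝔸ˣ))) (cornerSite L y) κ (boxVec L r) : 𝔸ˣ) : 𝔸) - 1‖ ≤ α)
    (hαL : 50 * (d + 1) * α * (L : ℝ) ^ d ≤ 1 / 2)
    {c₀ c₁ : ℝ} [Fact (0 < c₀)] [Fact (0 < c₁)] {a : ℝ} (ha : 0 < a)
    {Wq : Space115 (L : ℝ) η lev₀ lev₁ (nabla115 η (fun _ : Bond d (fineP L m) => (1 : 𝔸ˣ))) → NegSize (L : ℝ) η lev₀ 3 𝔸} {C₄ a₃ : ℝ}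
    (hW : QuadAnalytic Wq C₄ a₃) (hC₄ : 0 ≤ C₄) (ha₃ : 0 < a₃) (hWa : AnalyticOnNhd ℂ Wq {Y | ‖Y‖ < a₃}) :
    ∃ ε₄ εC Rb R' : ℝ, 0 < Rb ∧ 0 < R' ∧
      DifferentiableOn ℂ (chartHB (frakGLatticeCLM (lev₀ := lev₀) φ (laplaceAofBackground_one_pos L m hL φ (c₀ := c₀) (c₁ := c₁) τ (ne_of_gt (Fact.out : 0 < η)) hα1 hU1 hreg ha) (QtorusW_surjective L m hL (fun _ : Bond d (fineP L m) => (1 : 𝔸ˣ)) hα1 hU1 hreg hαL φ) lev₁ (nabla115 η (fun _ : Bond d (fineP L m) => (1 : 𝔸ˣ))))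
          0 Wq 0 (fun A' => A' + solA (H1LatticeCLM (lev₀ := lev₀) (levB := levB) φ (laplaceAofBackground_one_pos L m hL φ (c₀ := c₀) (c₁ := c₁) τ (ne_of_gt (Fact.out : 0 < η)) hα1 hU1 hreg ha) (QtorusW_surjective L m hL (fun _ : Bond d (fineP L m) => (1 : 𝔸ˣ)) hα1 hU1 hreg hαL φ) lev₁ (nabla115 η (fun _ : Bond d (fineP L m) => (1 : 𝔸ˣ))))
            0 (Cc L m η (fun _ : Bond d (fineP L m) => (1 : 𝔸ˣ)) lev₀ lev₁ (nabla115 η (fun _ : Bond d (fineP L m) => (1 : 𝔸ˣ))) levB) 0 εC A') ε₄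
          (H1LatticeCLM (lev₀ := lev₀) (levB := levB) φ (laplaceAofBackground_one_pos L m hL φ (c₀ := c₀) (c₁ := c₁) τ (ne_of_gt (Fact.out : 0 < η)) hα1 hU1 hreg ha) (QtorusW_surjective L m hL (fun _ : Bond d (fineP L m) => (1 : 𝔸ˣ)) hα1 hU1 hreg hαL φ) lev₁ (nabla115 η (fun _ : Bond d (fineP L m) => (1 : 𝔸ˣ)))))
        (ball (0 : NegSize (L : ℝ) η levB 0 𝔸) Rb) ∧
      MapsTo (chartHB (frakGLatticeCLM (lev₀ := lev₀) φ (laplaceAofBackground_one_pos L m hL φ (c₀ := c₀) (c₁ := c₁) τ (ne_of_gt (Fact.out : 0 < η)) hα1 hU1 hreg ha) (QtorusW_surjective L m hL (fun _ : Bond d (fineP L m) => (1 : 𝔸ˣ)) hα1 hU1 hreg hαL φ) lev₁ (nabla115 η (fun _ : Bond d (fineP L m) => (1 : 𝔸ˣ))))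
          0 Wq 0 (fun A' => A' + solA (H1LatticeCLM (lev₀ := lev₀) (levB := levB) φ (laplaceAofBackground_one_pos L m hL φ (c₀ := c₀) (c₁ := c₁) τ (ne_of_gt (Fact.out : 0 < η)) hα1 hU1 hreg ha) (QtorusW_surjective L m hL (fun _ : Bond d (fineP L m) => (1 : 𝔸ˣ)) hα1 hU1 hreg hαL φ) lev₁ (nabla115 η (fun _ : Bond d (fineP L m) => (1 : 𝔸ˣ))))
            0 (Cc L m η (fun _ : Bond d (fineP L m) => (1 : 𝔸ˣ)) lev₀ lev₁ (nabla115 η (fun _ : Bond d (fineP L m) => (1 : 𝔸ˣ))) levB) 0 εC A') ε₄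
          (H1LatticeCLM (lev₀ := lev₀) (levB := levB) φ (laplaceAofBackground_one_pos L m hL φ (c₀ := c₀) (c₁ := c₁) τ (ne_of_gt (Fact.out : 0 < η)) hα1 hU1 hreg ha) (QtorusW_surjective L m hL (fun _ : Bond d (fineP L m) => (1 : 𝔸ˣ)) hα1 hU1 hreg hαL φ) lev₁ (nabla115 η (fun _ : Bond d (fineP L m) => (1 : 𝔸ˣ)))))
        (ball (0 : NegSize (L : ℝ) η levB 0 𝔸) Rb) (ball (0 : Space115 (L : ℝ) η lev₀ lev₁ (nabla115 η (fun _ : Bond d (fineP L m) => (1 : 𝔸ˣ)))) R') ∧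
      chartHB (frakGLatticeCLM (lev₀ := lev₀) φ (laplaceAofBackground_one_pos L m hL φ (c₀ := c₀) (c₁ := c₁) τ (ne_of_gt (Fact.out : 0 < η)) hα1 hU1 hreg ha) (QtorusW_surjective L m hL (fun _ : Bond d (fineP L m) => (1 : 𝔸ˣ)) hα1 hU1 hreg hαL φ) lev₁ (nabla115 η (fun _ : Bond d (fineP L m) => (1 : 𝔸ˣ))))
          0 Wq 0 (fun A' => A' + solA (H1LatticeCLM (lev₀ := lev₀) (levB := levB) φ (laplaceAofBackground_one_pos L m hL φ (c₀ := c₀) (c₁ := c₁) τ (ne_of_gt (Fact.out : 0 < η)) hα1 hU1 hreg ha) (QtorusW_surjective L m hL (fun _ : Bond d (fineP L m) => (1 : 𝔸ˣ)) hα1 hU1 hreg hαL φ) lev₁ (nabla115 η (fun _ : Bond d (fineP L m) => (1 : 𝔸ˣ))))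
            0 (Cc L m η (fun _ : Bond d (fineP L m) => (1 : 𝔸ˣ)) lev₀ lev₁ (nabla115 η (fun _ : Bond d (fineP L m) => (1 : 𝔸ˣ))) levB) 0 εC A') ε₄
          (H1LatticeCLM (lev₀ := lev₀) (levB := levB) φ (laplaceAofBackground_one_pos L m hL φ (c₀ := c₀) (c₁ := c₁) τ (ne_of_gt (Fact.out : 0 < η)) hα1 hU1 hreg ha) (QtorusW_surjective L m hL (fun _ : Bond d (fineP L m) => (1 : 𝔸ˣ)) hα1 hU1 hreg hαL φ) lev₁ (nabla115 η (fun _ : Bond d (fineP L m) => (1 : 𝔸ˣ)))) 0 = 0 :=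
  cur_chart_exists_of_W_H126 L m hL φ τ lev₁ hlev (fun _ => 1) hα hα1 hU1 hreg hαL a
    (laplaceAofBackground_one_pos L m hL φ (c₀ := c₀) (c₁ := c₁) τ (ne_of_gt (Fact.out : 0 < η)) hα1 hU1 hreg ha) hW hC₄ ha₃ hWa

set_option maxRecDepth 8192 in
/-- **THE SAME, CLOSED IN THE BACKGROUND-DATA LETTERS** (`α := 0`: `1 ∈ U1` and `W_{c,x}(1) = 1`, `B5Eq172FlatCoercivity.hU1_one`∕`hreg_one`;
`hpos := laplaceAofBackground_one_pos₀`): at `U = 1` the chart of the curve species exists given ONLY the (L3) letter `W` (quadratic-analytic),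
`1 ≤ lev₀`, `0 < a` and the trivial regime inequality `50(d+1)·0·L^d ≤ 1/2` (kept as the letter `hαL0` because `QtorusW_surjective` is stated
with it). [folklore] -/
theorem cur_chart_exists_flat₀ {d : ℕ} (L : ℕ) [NeZero L] (m : Fin d → ℕ) [∀ i, NeZero (fineP L m i)] (hL : 1 ≤ L)
    {𝔸 : Type*} [NormedRing 𝔸] [NormedAlgebra ℂ 𝔸] [CompleteSpace 𝔸] [NormOneClass 𝔸] [StarRing 𝔸] [StarModule ℂ 𝔸] [FiniteDimensional ℂ 𝔸]
    {W : Type*} [NormedAddCommGroup W] [InnerProductSpace ℂ W] [FiniteDimensional ℂ W] (φ : W ≃ₗ[ℂ] 𝔸) (τ : 𝔸 →ₗ[ℂ] ℂ)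
    {η : ℝ} [Fact (0 < (L : ℝ))] [Fact (0 < η)] {lev₀ : Bond d (fineP L m) → ℕ} {levB : Bond d m → ℕ} (lev₁ : Bond d (fineP L m) × Fin d → ℕ)
    (hlev : ∀ b, 1 ≤ lev₀ b) (hαL0 : 50 * (d + 1) * (0 : ℝ) * (L : ℝ) ^ d ≤ 1 / 2)
    {c₀ c₁ : ℝ} [Fact (0 < c₀)] [Fact (0 < c₁)] {a : ℝ} (ha : 0 < a)
    {Wq : Space115 (L : ℝ) η lev₀ lev₁ (nabla115 η (fun _ : Bond d (fineP L m) => (1 : 𝔸ˣ))) → NegSize (L : ℝ) η lev₀ 3 𝔸} {C₄ a₃ : ℝ}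
    (hW : QuadAnalytic Wq C₄ a₃) (hC₄ : 0 ≤ C₄) (ha₃ : 0 < a₃) (hWa : AnalyticOnNhd ℂ Wq {Y | ‖Y‖ < a₃}) :
    ∃ ε₄ εC Rb R' : ℝ, 0 < Rb ∧ 0 < R' ∧
      DifferentiableOn ℂ (chartHB (frakGLatticeCLM (lev₀ := lev₀) φ (laplaceAofBackground_one_pos₀ L m hL φ (c₀ := c₀) (c₁ := c₁) (ne_of_gt (Fact.out : 0 < η)) ha τ) (QtorusW_surjective L m hL (fun _ : Bond d (fineP L m) => (1 : 𝔸ˣ)) (show (0 : ℝ) ≤ 1 / 64 by norm_num) (hU1_one L m) (hreg_one L m) hαL0 φ) lev₁ (nabla115 η (fun _ : Bond d (fineP L m) => (1 : 𝔸ˣ))))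
          0 Wq 0 (fun A' => A' + solA (H1LatticeCLM (lev₀ := lev₀) (levB := levB) φ (laplaceAofBackground_one_pos₀ L m hL φ (c₀ := c₀) (c₁ := c₁) (ne_of_gt (Fact.out : 0 < η)) ha τ) (QtorusW_surjective L m hL (fun _ : Bond d (fineP L m) => (1 : 𝔸ˣ)) (show (0 : ℝ) ≤ 1 / 64 by norm_num) (hU1_one L m) (hreg_one L m) hαL0 φ) lev₁ (nabla115 η (fun _ : Bond d (fineP L m) => (1 : 𝔸ˣ))))
            0 (Cc L m η (fun _ : Bond d (fineP L m) => (1 : 𝔸ˣ)) lev₀ lev₁ (nabla115 η (fun _ : Bond d (fineP L m) => (1 : 𝔸ˣ))) levB) 0 εC A') ε₄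
          (H1LatticeCLM (lev₀ := lev₀) (levB := levB) φ (laplaceAofBackground_one_pos₀ L m hL φ (c₀ := c₀) (c₁ := c₁) (ne_of_gt (Fact.out : 0 < η)) ha τ) (QtorusW_surjective L m hL (fun _ : Bond d (fineP L m) => (1 : 𝔸ˣ)) (show (0 : ℝ) ≤ 1 / 64 by norm_num) (hU1_one L m) (hreg_one L m) hαL0 φ) lev₁ (nabla115 η (fun _ : Bond d (fineP L m) => (1 : 𝔸ˣ)))))
        (ball (0 : NegSize (L : ℝ) η levB 0 𝔸) Rb) ∧
      MapsTo (chartHB (frakGLatticeCLM (lev₀ := lev₀) φ (laplaceAofBackground_one_pos₀ L m hL φ (c₀ := c₀) (c₁ := c₁) (ne_of_gt (Fact.out : 0 < η)) ha τ) (QtorusW_surjective L m hL (fun _ : Bond d (fineP L m) => (1 : 𝔸ˣ)) (show (0 : ℝ) ≤ 1 / 64 by norm_num) (hU1_one L m) (hreg_one L m) hαL0 φ) lev₁ (nabla115 η (fun _ : Bond d (fineP L m) => (1 : 𝔸ˣ))))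
          0 Wq 0 (fun A' => A' + solA (H1LatticeCLM (lev₀ := lev₀) (levB := levB) φ (laplaceAofBackground_one_pos₀ L m hL φ (c₀ := c₀) (c₁ := c₁) (ne_of_gt (Fact.out : 0 < η)) ha τ) (QtorusW_surjective L m hL (fun _ : Bond d (fineP L m) => (1 : 𝔸ˣ)) (show (0 : ℝ) ≤ 1 / 64 by norm_num) (hU1_one L m) (hreg_one L m) hαL0 φ) lev₁ (nabla115 η (fun _ : Bond d (fineP L m) => (1 : 𝔸ˣ))))
            0 (Cc L m η (fun _ : Bond d (fineP L m) => (1 : 𝔸ˣ)) lev₀ lev₁ (nabla115 η (fun _ : Bond d (fineP L m) => (1 : 𝔸ˣ))) levB) 0 εC A') ε₄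
          (H1LatticeCLM (lev₀ := lev₀) (levB := levB) φ (laplaceAofBackground_one_pos₀ L m hL φ (c₀ := c₀) (c₁ := c₁) (ne_of_gt (Fact.out : 0 < η)) ha τ) (QtorusW_surjective L m hL (fun _ : Bond d (fineP L m) => (1 : 𝔸ˣ)) (show (0 : ℝ) ≤ 1 / 64 by norm_num) (hU1_one L m) (hreg_one L m) hαL0 φ) lev₁ (nabla115 η (fun _ : Bond d (fineP L m) => (1 : 𝔸ˣ)))))
        (ball (0 : NegSize (L : ℝ) η levB 0 𝔸) Rb) (ball (0 : Space115 (L : ℝ) η lev₀ lev₁ (nabla115 η (fun _ : Bond d (fineP L m) => (1 : 𝔸ˣ)))) R') ∧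
      chartHB (frakGLatticeCLM (lev₀ := lev₀) φ (laplaceAofBackground_one_pos₀ L m hL φ (c₀ := c₀) (c₁ := c₁) (ne_of_gt (Fact.out : 0 < η)) ha τ) (QtorusW_surjective L m hL (fun _ : Bond d (fineP L m) => (1 : 𝔸ˣ)) (show (0 : ℝ) ≤ 1 / 64 by norm_num) (hU1_one L m) (hreg_one L m) hαL0 φ) lev₁ (nabla115 η (fun _ : Bond d (fineP L m) => (1 : 𝔸ˣ))))
          0 Wq 0 (fun A' => A' + solA (H1LatticeCLM (lev₀ := lev₀) (levB := levB) φ (laplaceAofBackground_one_pos₀ L m hL φ (c₀ := c₀) (c₁ := c₁) (ne_of_gt (Fact.out : 0 < η)) ha τ) (QtorusW_surjective L m hL (fun _ : Bond d (fineP L m) => (1 : 𝔸ˣ)) (show (0 : ℝ) ≤ 1 / 64 by norm_num) (hU1_one L m) (hreg_one L m) hαL0 φ) lev₁ (nabla115 η (fun _ : Bond d (fineP L m) => (1 : 𝔸ˣ))))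
            0 (Cc L m η (fun _ : Bond d (fineP L m) => (1 : 𝔸ˣ)) lev₀ lev₁ (nabla115 η (fun _ : Bond d (fineP L m) => (1 : 𝔸ˣ))) levB) 0 εC A') ε₄
          (H1LatticeCLM (lev₀ := lev₀) (levB := levB) φ (laplaceAofBackground_one_pos₀ L m hL φ (c₀ := c₀) (c₁ := c₁) (ne_of_gt (Fact.out : 0 < η)) ha τ) (QtorusW_surjective L m hL (fun _ : Bond d (fineP L m) => (1 : 𝔸ˣ)) (show (0 : ℝ) ≤ 1 / 64 by norm_num) (hU1_one L m) (hreg_one L m) hαL0 φ) lev₁ (nabla115 η (fun _ : Bond d (fineP L m) => (1 : 𝔸ˣ)))) 0 = 0 :=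
  cur_chart_exists_flat L m hL φ τ lev₁ hlev (by norm_num) (by norm_num) (hU1_one L m) (hreg_one L m) hαL0 ha hW hC₄ ha₃ hWa

end Flat

/-! ## v1.3 (gen 80, APPEND-ONLY): AT EVERY SMALL FIELD `hpos` IS A THEOREM — the chart of `cur U` exists given ONLY `W`, `hRS`, `C_τ`, `M_φ`, `M_φ′` -/

section SmallField

open Literature.MathematicalPhysics.QuantumFieldTheory.Balaban1983to89.B9Thm311SmallFieldClosed (laplaceAofBackground_pos_of_small_field)
open B9Eq310HessianOperator (adTransportW)

/-- **THE CHART OF THE CURVE SPECIES `cur U` EXISTS AT EVERY SMALL FIELD `U` OF A FIXED LATTICE, GIVEN ONLY THE (L3) LETTER `W`** (and the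
mutual adjointness `hRS` of the transporters `R(U(b))`, `R(U(b)⁻¹)` read on the fibre, the trace/fibre bounds `C_τ`, `M_φ`, `M_φ′`, `0 < a`): there is
`ε₃ > 0` (a finite-lattice number) such that for EVERY background `U` of E162's data with `‖U(b) − 1‖ ≤ ε ≤ ε₃` the displayed positivity `hpos`
([Balaban1985BackgroundPropagators] Thm 3.11 for the assembled `Δ_a(U)`) HOLDS — `B9Thm311SmallFieldClosed.laplaceAofBackground_pos_of_small_field`,
the junction of the owner's `B9Eq368ProjectionRemainder` / `B9Eq373DerivativeRemainderL2` / `B9Eq384RemainderLetters` / `B9Thm311SmallFieldCoercivity`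
(the `R(U)`, `D`, `D*`, `D*D`, `Δ^η_U` remainders, the flat modulus, (3.84)), NE9 leaf-03's `B9Eq319QprimeLipschitz` (`Q′(U)`), NE9 leaf-04's
`B9Eq315QLipschitz` (`Q(U)`), `B9Ineq369CurvatureSmall` (`Δ′(U)`) and the flat step `B5Eq172FlatCoercivity` ([Balaban1984PropagatorsI] (1.72)) —
and hence, for ANY quadratic-analytic `W` and `1 ≤ lev₀`, lit-balaban's chart (174)∘(47) of `cur U` satisfies (Ψ1)–(Ψ3) on some ball
(`cur_chart_exists_of_W_H126` at that `hpos`).  NOT print's uniform statement (`ε₃` depends on the lattice); NOT the (L3) `W` itself. [folklore] -/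
theorem cur_chart_exists_of_small_field {d : ℕ} (L : ℕ) [NeZero L] (m : Fin d → ℕ) [∀ i, NeZero (fineP L m i)] (hL : 1 ≤ L)
    {𝔸 : Type*} [NormedRing 𝔸] [NormedAlgebra ℂ 𝔸] [CompleteSpace 𝔸] [NormOneClass 𝔸] [StarRing 𝔸] [NormedStarGroup 𝔸] [StarModule ℂ 𝔸]
    [FiniteDimensional ℂ 𝔸]
    {W : Type*} [NormedAddCommGroup W] [InnerProductSpace ℂ W] [FiniteDimensional ℂ W] (φ : W ≃ₗ[ℂ] 𝔸) {Mφ Mφ' : ℝ} (hMφ : 0 ≤ Mφ)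
    (hMφ' : 0 ≤ Mφ') (hφ : ∀ w, ‖φ w‖ ≤ Mφ * ‖w‖) (hφ' : ∀ X, ‖φ.symm X‖ ≤ Mφ' * ‖X‖)
    (τ : 𝔸 →ₗ[ℂ] ℂ) {Cτ : ℝ} (hτ : ∀ X, ‖τ X‖ ≤ Cτ * ‖X‖) (hCτ : 0 ≤ Cτ)
    {η : ℝ} [Fact (0 < (L : ℝ))] [Fact (0 < η)] {lev₀ : Bond d (fineP L m) → ℕ} {levB : Bond d m → ℕ} (lev₁ : Bond d (fineP L m) × Fin d → ℕ)
    (hlev : ∀ b, 1 ≤ lev₀ b) {c₀ c₁ : ℝ} [Fact (0 < c₀)] [Fact (0 < c₁)] {a : ℝ} (ha : 0 < a) :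
    ∃ ε₃ : ℝ, 0 < ε₃ ∧ ∀ (U : Bond d (fineP L m) → 𝔸ˣ) {α : ℝ} (hα : α ≤ 1 / 128) (hα1 : α ≤ 1 / 64)
      (hU1 : ∀ (x : B7Prop1Explicit.Site d) (κ : Fin d), perCfg (fineP L m) U x κ ∈ U1 𝔸)
      (hreg : ∀ (y : TSite d m) (κ : Fin d) (r : Fin d → Fin L),
        ‖((Wcx L (perCfg (fineP L m) U) (cornerSite L y) κ (boxVec L r) : 𝔸ˣ) : 𝔸) - 1‖ ≤ α)
      (hαL : 50 * (d + 1) * α * (L : ℝ) ^ d ≤ 1 / 2) {ε : ℝ}, 0 ≤ ε → ε ≤ ε₃ → (∀ b, ‖(U b : 𝔸) - 1‖ ≤ ε) →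
      (∀ (b : Bond d (fineP L m)) (v u : W), inner ℂ (adTransportW φ U b v) u = inner ℂ v (adTransportW φ (fun b => (U b)⁻¹) b u)) →
      ∀ {Wq : Space115 (L : ℝ) η lev₀ lev₁ (nabla115 η U) → NegSize (L : ℝ) η lev₀ 3 𝔸} {C₄ a₃ : ℝ}, QuadAnalytic Wq C₄ a₃ → 0 ≤ C₄ →
        0 < a₃ → AnalyticOnNhd ℂ Wq {Y | ‖Y‖ < a₃} →
      ∃ hpos : ∀ x : BondL2K ℂ d (fineP L m) c₀ W, x ≠ 0 →
          0 < RCLike.re (inner ℂ x (laplaceAofBackground L m hL φ U hα1 hU1 hreg τ η (c₀ := c₀) (c₁ := c₁) a x)),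
      ∃ ε₄ εC Rb R' : ℝ, 0 < Rb ∧ 0 < R' ∧
        DifferentiableOn ℂ (chartHB (frakGLatticeCLM (lev₀ := lev₀) φ hpos (QtorusW_surjective L m hL U hα1 hU1 hreg hαL φ) lev₁ (nabla115 η U))
            0 Wq 0 (fun A' => A' + solA (H1LatticeCLM (lev₀ := lev₀) (levB := levB) φ hpos (QtorusW_surjective L m hL U hα1 hU1 hreg hαL φ) lev₁ (nabla115 η U))
              0 (Cc L m η U lev₀ lev₁ (nabla115 η U) levB) 0 εC A') ε₄
            (H1LatticeCLM (lev₀ := lev₀) (levB := levB) φ hpos (QtorusW_surjective L m hL U hα1 hU1 hreg hαL φ) lev₁ (nabla115 η U)))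
          (ball (0 : NegSize (L : ℝ) η levB 0 𝔸) Rb) ∧
        MapsTo (chartHB (frakGLatticeCLM (lev₀ := lev₀) φ hpos (QtorusW_surjective L m hL U hα1 hU1 hreg hαL φ) lev₁ (nabla115 η U))
            0 Wq 0 (fun A' => A' + solA (H1LatticeCLM (lev₀ := lev₀) (levB := levB) φ hpos (QtorusW_surjective L m hL U hα1 hU1 hreg hαL φ) lev₁ (nabla115 η U))
              0 (Cc L m η U lev₀ lev₁ (nabla115 η U) levB) 0 εC A') ε₄
            (H1LatticeCLM (lev₀ := lev₀) (levB := levB) φ hpos (QtorusW_surjective L m hL U hα1 hU1 hreg hαL φ) lev₁ (nabla115 η U)))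
          (ball (0 : NegSize (L : ℝ) η levB 0 𝔸) Rb) (ball (0 : Space115 (L : ℝ) η lev₀ lev₁ (nabla115 η U)) R') ∧
        chartHB (frakGLatticeCLM (lev₀ := lev₀) φ hpos (QtorusW_surjective L m hL U hα1 hU1 hreg hαL φ) lev₁ (nabla115 η U))
            0 Wq 0 (fun A' => A' + solA (H1LatticeCLM (lev₀ := lev₀) (levB := levB) φ hpos (QtorusW_surjective L m hL U hα1 hU1 hreg hαL φ) lev₁ (nabla115 η U))
              0 (Cc L m η U lev₀ lev₁ (nabla115 η U) levB) 0 εC A') ε₄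
            (H1LatticeCLM (lev₀ := lev₀) (levB := levB) φ hpos (QtorusW_surjective L m hL U hα1 hU1 hreg hαL φ) lev₁ (nabla115 η U)) 0 = 0 := by
  obtain ⟨ε₃, hε₃, H⟩ := laplaceAofBackground_pos_of_small_field L m hL φ (c₀ := c₀) (c₁ := c₁) (ne_of_gt (Fact.out : 0 < η)) ha hMφ hMφ' hφ hφ'
    τ hτ hCτ
  refine ⟨ε₃, hε₃, fun U α hα hα1 hU1 hreg hαL ε hε hεε₃ hUε hRS Wq C₄ a₃ hW hC₄ ha₃ hWa => ?_⟩
  exact ⟨H U hα1 hU1 hreg hε hεε₃ hUε hRS, cur_chart_exists_of_W_H126 L m hL φ τ lev₁ hlev U hα hα1 hU1 hreg hαL a _ hW hC₄ ha₃ hWa⟩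

end SmallField

end Summit.QuantumFields.BalabanUV.T4Continuum.NE9CurChartOfBackground

end
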